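import Summits.CriticalPhenomena.Ising3DConformalLimit.Theses.SynchronousCoupling
import Summits.CriticalPhenomena.Ising3DConformalLimit.Theorems.HyperoctahedralRPExistsScaleCovariantLimitCompactnessItemMapsDoubling
import Summits.CriticalPhenomena.Ising3DConformalLimit.Theorems.SynchronousCouplingUniformRegularityStubFieldMonotone
import Summits.CriticalPhenomena.Ising3DConformalLimit.Theorems.SynchronousCouplingUniformRegularityStubGhsSandwich
import Summits.CriticalPhenomena.Ising3DConformalLimit.Theorems.SynchronousCouplingUniformRegularityStubMagnetizationRegular
import Summits.CriticalPhenomena.Ising3DConformalLimit.Theorems.SynchronousCouplingUniformRegularityStubTruncatedSumRule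
import Literature.Probability.LatticeModels.CriticalTwoPointLawDimension
import Literature.Probability.LatticeModels.PointwiseScalingLimitEtaExists
import HarnessLib

/-!
# The magnetic-ruler transfer: `UniformRegularity` (stmt-CriticalPhenomena-4658) ⟺ one-octave excess-correlation
# propagation in a field (line `Sketch`, crux dir `Cruxes/UniformRegularity/Lines/Sketch.lean`)

Route `SynchronousCoupling` (crux shared with `ClusterRigidity`, `MonotoneRG`, `MirrorHoelderCompactness`). The line
(idea card `Cruxes/UniformRegularity/Ideas/magnetic-ruler.md`) deforms the critical model on `ℤ³` by a uniform field
`h > 0` at `β = β_c` and lays `M(h) := ⟨σ₀⟩⁺_{β_c,h}` (`magnetizationInField 3 (criticalBeta 3) h`) against the zero-field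
critical two-point function `g(x) := ⟨σ₀σ_x⟩⁺_{β_c,0}` (`criticalTwoPoint 3 x`); `S_h(x) := ⟨σ₀σ_x⟩⁺_{β_c,h}`
(`plusCorr 3 (criticalBeta 3) h {0, x}`). Its four provable stubs are LANDED (`Theorems.MagneticRuler.stub_fieldMonotone`
p158710, `stub_ghsSandwich` p158984, `stub_magnetizationRegular` p158840, `stub_truncatedSumRule` p159073). This file is the
kernel-checked TRANSFER both ways between the remaining open stub

  `ECP` : `∃ K ≥ 2, κ > 0, h₀ > 0, ∀ h ∈ (0,h₀), ∀ n ≥ 1` with `β_c·n·h·M(h) ≤ 1`: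
          `K·M(h)² ≤ S_h(n e₀) ⟹ (1+κ)·M(h)² ≤ S_h(2n e₀)`

(one-octave excess-correlation propagation inside the magnetic window) and the crux:

* `twoPointDoubling_of_excessPropagation` — ECP ⟹ item 6150 `TwoPointDoubling` (IVT in the field: for `g(n e₀)` below
  the threshold `K·M(h₀/2)²` pick `h⋆` with `K·M(h⋆)² = g(n e₀)`; the window holds by the anchored GHS sum rule on
  `{e₀,…,n e₀}`; the ECP hypothesis holds by GKS; the conclusion reads `g(2n e₀) ≥ κM(h⋆)² = (κ/K) g(n e₀)` by GHS;
  finitely many large-`g` scales by positivity and axis monotonicity);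
* `excessPropagation_of_twoPointDoubling` — item 6150 ⟹ ECP (`K = 2 + 2/κ₀`, `κ = 1`, window unused);
* `uniformRegularity_of_excessPropagation`, `uniformRegularity_iff_excessPropagation` — through the landed item map
  `uniformRegularity_iff_doubling` (p120504; the `MonotoneRG` and `SynchronousCoupling` copies of the decl are `Iff.rfl`).

So the crux is EXACTLY the one-octave, one-model statement ECP about the massive, unique state `(β_c, h > 0)` — no
strength added or lost. References: Fernández–Fröhlich–Sokal 1992 §12.4, §14.3.5 [FFS1992]; Lebowitz 1974
[Lebowitz1974]; Aizenman–Duminil-Copin 2021 §5.6 [AizenmanDuminilCopinAnnals2021].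
-/

noncomputable section

namespace Summit.CriticalPhenomena.Ising3DConformalLimit.Theorems.MagneticRuler

open scoped BigOperators Topology
open Filter Set
open Literature.Probability.LatticeModels

/-- The crux decl of route `SynchronousCoupling` is VERBATIM the `UniformRegularity` decl of route `MonotoneRG`
(shared item stmt-CriticalPhenomena-4658). [folklore] -/
theorem monotoneRG_uniformRegularity_iff_synchronousCoupling :
    Summit.CriticalPhenomena.Ising3DConformalLimit.Theses.MonotoneRG.UniformRegularity ↔
      Summit.CriticalPhenomena.Ising3DConformalLimit.Theses.SynchronousCoupling.UniformRegularity :=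
  Iff.rfl

/-- The axis point `n e₀` of `ℤ³` is nonzero for `n ≠ 0`. [folklore] -/
theorem single_axis_ne_zero {n : ℤ} (hn : n ≠ 0) : (Pi.single 0 n : Site 3) ≠ 0 := by
  intro h
  have := congrFun h 0
  simp only [Pi.single_eq_same, Pi.zero_apply] at this
  exact hn this

/-- The critical axis two-point function `n ↦ g(n e₀)` tends to `0` (landed squeeze `c‖x‖⁻² ≤ g ≤ C‖x‖⁻¹`). [folklore] -/
theorem axis_tendsto_zero :
    Tendsto (fun n : ℕ => criticalTwoPoint 3 (Pi.single 0 (n : ℤ))) atTop (𝓝 0) :=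
  criticalTwoPoint_tendsto_zero_cofinite.comp tendsto_natCast_single_axis_cofinite

/-- **The magnetic window from the sum rule.** If `h > 0`, `M(h) > 0`, `n ≥ 1` and every axis pair correlation
`S_h(k e₀) − M(h)²`, `1 ≤ k ≤ n`, is at least `M(h)²`, then the anchored sum rule on `Λ = {e₀,…,n e₀}` gives
`β_c · n · h · M(h) ≤ 1`. [FFS1992 §14.3.5] -/
theorem window_of_sumRule {h : ℝ} (hh : 0 < h)
    (hM : 0 < magnetizationInField 3 (criticalBeta 3) h) {n : ℕ}
    (hterm : ∀ k : ℕ, 1 ≤ k → k ≤ n →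
      (magnetizationInField 3 (criticalBeta 3) h) ^ 2 ≤
        plusCorr 3 (criticalBeta 3) h {0, Pi.single 0 (k : ℤ)} - (magnetizationInField 3 (criticalBeta 3) h) ^ 2) :
    criticalBeta 3 * ((n : ℝ) * h * magnetizationInField 3 (criticalBeta 3) h) ≤ 1 := by
  set M := magnetizationInField 3 (criticalBeta 3) h with hMdef
  set f : ℕ → Site 3 := fun k => Pi.single 0 (k : ℤ) with hf
  have hfinj : Function.Injective f := by
    intro a b hab
    have := congrFun hab 0
    simpa [hf] using this
  set Λ : Finset (Site 3) := (Finset.Icc 1 n).image f with hΛ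
  have h0 : (0 : Site 3) ∉ Λ := by
    intro hmem
    obtain ⟨k, hk, hk0⟩ := Finset.mem_image.1 hmem
    have hk1 : 1 ≤ k := (Finset.mem_Icc.1 hk).1
    have : (Pi.single 0 (k : ℤ) : Site 3) ≠ 0 := single_axis_ne_zero (by exact_mod_cast (by omega : k ≠ 0))
    exact this hk0
  have hsum := stub_truncatedSumRule h hh Λ h0
  have hβ : 0 ≤ criticalBeta 3 := criticalBeta_nonneg 3
  -- the sum over Λ is at least n · M²
  have hlow : (n : ℝ) * M ^ 2 ≤ ∑ x ∈ Λ, (plusCorr 3 (criticalBeta 3) h {0, x} - M ^ 2) := by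
    rw [hΛ, Finset.sum_image fun a _ b _ hab => hfinj hab]
    have : ∑ _k ∈ Finset.Icc 1 n, M ^ 2 = (n : ℝ) * M ^ 2 := by
      rw [Finset.sum_const, Nat.card_Icc, nsmul_eq_mul]
      push_cast
      ring_nf
    rw [← this]
    exact Finset.sum_le_sum fun k hk => hterm k (Finset.mem_Icc.1 hk).1 (Finset.mem_Icc.1 hk).2
  have h1 : criticalBeta 3 * h * ((n : ℝ) * M ^ 2) ≤ M :=
    le_trans (mul_le_mul_of_nonneg_left hlow (mul_nonneg hβ hh.le)) hsum
  -- divide by M > 0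
  have h2 : criticalBeta 3 * ((n : ℝ) * h * M) * M ≤ 1 * M := by nlinarith [h1]
  exact le_of_mul_le_mul_right h2 hM

/-- **ECP ⟹ item 6150 `TwoPointDoubling`** (the transfer of the magnetic ruler). [folklore] -/
theorem twoPointDoubling_of_excessPropagation (h₅ : (∃ K κ h₀ : ℝ, 2 ≤ K ∧ 0 < κ ∧ 0 < h₀ ∧ ∀ h ∈ Set.Ioo (0 : ℝ) h₀, ∀ n : ℕ, 1 ≤ n →
      Literature.Probability.LatticeModels.criticalBeta 3 *
          ((n : ℝ) * h * Literature.Probability.LatticeModels.magnetizationInField 3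
            (Literature.Probability.LatticeModels.criticalBeta 3) h) ≤ 1 →
      K * (Literature.Probability.LatticeModels.magnetizationInField 3
            (Literature.Probability.LatticeModels.criticalBeta 3) h) ^ 2 ≤
        Literature.Probability.LatticeModels.plusCorr 3 (Literature.Probability.LatticeModels.criticalBeta 3) h
          {0, Pi.single 0 (n : ℤ)} →
      (1 + κ) * (Literature.Probability.LatticeModels.magnetizationInField 3
            (Literature.Probability.LatticeModels.criticalBeta 3) h) ^ 2 ≤
        Literature.Probability.LatticeModels.plusCorr 3 (Literature.Probability.LatticeModels.criticalBeta 3) h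
          {0, Pi.single 0 (2 * (n : ℤ))})) :
    Summit.CriticalPhenomena.Ising3DConformalLimit.Theses.MirrorHoelderCompactness.TwoPointDoubling := by
  obtain ⟨K, κ, h₀, hK, hκ, hh₀, hECP⟩ := h₅
  obtain ⟨hcont, hlim, hMpos⟩ := stub_magnetizationRegular
  set M : ℝ → ℝ := fun h => magnetizationInField 3 (criticalBeta 3) h with hMdef
  set G : ℕ → ℝ := fun n => criticalTwoPoint 3 (Pi.single 0 (n : ℤ)) with hGdef
  have hGpos : ∀ n, 0 < G n := fun n => criticalTwoPoint_axis_pos n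
  have hGanti : Antitone G := criticalTwoPoint_axis_antitone
  have hKpos : 0 < K := by linarith
  -- threshold field and threshold level
  set b : ℝ := h₀ / 2 with hbdef
  have hb : 0 < b := by positivity
  have hb₀ : b < h₀ := by rw [hbdef]; linarith
  have hMb : 0 < M b := hMpos b hb
  set γ : ℝ := K * M b ^ 2 with hγdef
  have hγ : 0 < γ := by positivity
  -- beyond N₀ the axis two-point function is below the threshold level
  obtain ⟨N₀, hN₀⟩ : ∃ N₀ : ℕ, ∀ n ≥ N₀, G n ≤ γ := by
    have hev : ∀ᶠ n in atTop, G n ≤ γ := (axis_tendsto_zero.eventually (eventually_le_nhds hγ))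
    exact eventually_atTop.1 hev
  have hcast : ∀ n : ℕ, ((2 * n : ℕ) : ℤ) = 2 * (n : ℤ) := fun n => by push_cast; ring
  refine ⟨min (G (2 * (N₀ + 1))) (κ / K), lt_min (hGpos _) (by positivity), fun n hn => ?_⟩
  rw [← hcast n]
  change min (G (2 * (N₀ + 1))) (κ / K) * G n ≤ G (2 * n)
  by_cases hsmall : n ≤ N₀
  · -- finitely many scales: positivity and axis monotonicity
    have h2n : G (2 * (N₀ + 1)) ≤ G (2 * n) := hGanti (by omega)
    have hGn1 : G n ≤ 1 := criticalTwoPoint_le_one' _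
    calc min (G (2 * (N₀ + 1))) (κ / K) * G n ≤ G (2 * (N₀ + 1)) * G n :=
          mul_le_mul_of_nonneg_right (min_le_left _ _) (hGpos n).le
      _ ≤ G (2 * (N₀ + 1)) * 1 := mul_le_mul_of_nonneg_left hGn1 (hGpos _).le
      _ ≤ G (2 * n) := by rw [mul_one]; exact h2n
  · -- the ruler: choose h⋆ with K · M(h⋆)² = G n
    push Not at hsmall
    have hGnγ : G n ≤ γ := hN₀ n hsmall.le
    -- a small field a ∈ (0, h₁) with K · M(a)² ≤ G n
    obtain ⟨a, ha0, hab, haG⟩ : ∃ a : ℝ, 0 < a ∧ a < b ∧ K * M a ^ 2 ≤ G n := by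
      have hφ : Tendsto (fun h => K * M h ^ 2) (𝓝[>] (0 : ℝ)) (𝓝 (K * 0 ^ 2)) :=
        (hlim.pow 2).const_mul K
      rw [zero_pow two_ne_zero, mul_zero] at hφ
      have hev₁ : ∀ᶠ h in 𝓝[>] (0 : ℝ), K * M h ^ 2 ≤ G n := hφ.eventually (eventually_le_nhds (hGpos n))
      have hev₂ : ∀ᶠ h in 𝓝[>] (0 : ℝ), h ∈ Ioo 0 b := Ioo_mem_nhdsGT hb
      obtain ⟨a, ha, ha'⟩ := (hev₁.and hev₂).exists
      exact ⟨a, ha'.1, ha'.2, ha⟩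
    -- IVT on [a, b]
    have hφcont : ContinuousOn (fun h => K * M h ^ 2) (Icc a b) :=
      continuousOn_const.mul ((hcont.mono fun x hx => lt_of_lt_of_le ha0 hx.1).pow 2)
    obtain ⟨hs, ⟨has, hsb⟩, hseq⟩ : ∃ hs ∈ Icc a b, K * M hs ^ 2 = G n :=
      intermediate_value_Icc hab.le hφcont ⟨haG, hGnγ⟩
    have hs0 : 0 < hs := lt_of_lt_of_le ha0 has
    have hsIoo : hs ∈ Ioo 0 h₀ := ⟨hs0, lt_of_le_of_lt hsb hb₀⟩
    have hMs : 0 < M hs := hMpos hs hs0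
    -- the window, by the sum rule on Λ = {e₀, …, n e₀}
    have hwin : criticalBeta 3 * ((n : ℝ) * hs * M hs) ≤ 1 := by
      refine window_of_sumRule hs0 hMs fun k hk1 hkn => ?_
      have hk0 : (Pi.single 0 (k : ℤ) : Site 3) ≠ 0 := single_axis_ne_zero (by exact_mod_cast (by omega : k ≠ 0))
      have hlowk : G n ≤ plusCorr 3 (criticalBeta 3) hs {0, Pi.single 0 (k : ℤ)} :=
        le_trans (hGanti hkn) (stub_fieldMonotone hs hs0.le _ hk0)
      -- G n = K M² ≥ 2 M²
      have : 2 * M hs ^ 2 ≤ G n := by rw [← hseq]; exact mul_le_mul_of_nonneg_right hK (sq_nonneg _)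
      change M hs ^ 2 ≤ plusCorr 3 (criticalBeta 3) hs {0, Pi.single 0 (k : ℤ)} - M hs ^ 2
      linarith
    -- feed ECP
    have hn0 : (Pi.single 0 (n : ℤ) : Site 3) ≠ 0 := single_axis_ne_zero (by exact_mod_cast (by omega : n ≠ 0))
    have hhyp : K * M hs ^ 2 ≤ plusCorr 3 (criticalBeta 3) hs {0, Pi.single 0 (n : ℤ)} := by
      rw [hseq]; exact stub_fieldMonotone hs hs0.le _ hn0
    have hconc := hECP hs hsIoo n hn hwin hhyp
    -- read the conclusion back at h = 0 through the upper sandwich at 2n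
    have h2n0 : (Pi.single 0 (2 * (n : ℤ)) : Site 3) ≠ 0 :=
      single_axis_ne_zero (by exact_mod_cast (by omega : 2 * n ≠ 0))
    have hup := stub_ghsSandwich hs hs0.le _ h2n0
    rw [← hcast n] at hup hconc
    change plusCorr 3 (criticalBeta 3) hs {0, Pi.single 0 ((2 * n : ℕ) : ℤ)} ≤ G (2 * n) + M hs ^ 2 at hup
    have hkey : κ * M hs ^ 2 ≤ G (2 * n) := by linarith
    calc min (G (2 * (N₀ + 1))) (κ / K) * G n ≤ κ / K * G n :=
          mul_le_mul_of_nonneg_right (min_le_right _ _) (hGpos n).le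
      _ = κ * M hs ^ 2 := by rw [← hseq]; field_simp
      _ ≤ G (2 * n) := hkey

/-- **Item 6150 ⟹ ECP** with `K = 2 + 2/κ₀`, `κ = 1`, `h₀ = 1` (the window hypothesis is not used): the open stub of the
line is implied by the crux, so no strength is smuggled in. [folklore] -/
theorem excessPropagation_of_twoPointDoubling
    (hD : Summit.CriticalPhenomena.Ising3DConformalLimit.Theses.MirrorHoelderCompactness.TwoPointDoubling) :
    (∃ K κ h₀ : ℝ, 2 ≤ K ∧ 0 < κ ∧ 0 < h₀ ∧ ∀ h ∈ Set.Ioo (0 : ℝ) h₀, ∀ n : ℕ, 1 ≤ n →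
      Literature.Probability.LatticeModels.criticalBeta 3 *
          ((n : ℝ) * h * Literature.Probability.LatticeModels.magnetizationInField 3
            (Literature.Probability.LatticeModels.criticalBeta 3) h) ≤ 1 →
      K * (Literature.Probability.LatticeModels.magnetizationInField 3
            (Literature.Probability.LatticeModels.criticalBeta 3) h) ^ 2 ≤
        Literature.Probability.LatticeModels.plusCorr 3 (Literature.Probability.LatticeModels.criticalBeta 3) h
          {0, Pi.single 0 (n : ℤ)} →
      (1 + κ) * (Literature.Probability.LatticeModels.magnetizationInField 3
            (Literature.Probability.LatticeModels.criticalBeta 3) h) ^ 2 ≤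
        Literature.Probability.LatticeModels.plusCorr 3 (Literature.Probability.LatticeModels.criticalBeta 3) h
          {0, Pi.single 0 (2 * (n : ℤ))}) := by
  obtain ⟨κ₀, hκ₀, hd⟩ := hD
  refine ⟨2 + 2 / κ₀, 1, 1, by have := div_pos two_pos hκ₀; linarith, one_pos, one_pos, ?_⟩
  intro h hh n hn _ hhyp
  set M := magnetizationInField 3 (criticalBeta 3) h with hMdef
  have hn0 : (Pi.single 0 (n : ℤ) : Site 3) ≠ 0 := single_axis_ne_zero (by exact_mod_cast (by omega : n ≠ 0))
  have h2n0 : (Pi.single 0 (2 * (n : ℤ)) : Site 3) ≠ 0 :=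
    single_axis_ne_zero (by exact_mod_cast (by omega : 2 * n ≠ 0))
  have hup := stub_ghsSandwich h hh.1.le _ hn0
  -- g(n) ≥ (K - 1) M² = (1 + 2/κ₀) M²
  have hg : (1 + 2 / κ₀) * M ^ 2 ≤ criticalTwoPoint 3 (Pi.single 0 (n : ℤ)) := by linarith
  have hdn := hd n hn
  have hlow := stub_fieldMonotone h hh.1.le _ h2n0
  -- κ₀ g(n) ≥ (κ₀ + 2) M² ≥ 2 M²
  have hM2 : 0 ≤ M ^ 2 := sq_nonneg _
  have : (κ₀ + 2) * M ^ 2 ≤ κ₀ * criticalTwoPoint 3 (Pi.single 0 (n : ℤ)) := by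
    have := mul_le_mul_of_nonneg_left hg hκ₀.le
    calc (κ₀ + 2) * M ^ 2 = κ₀ * ((1 + 2 / κ₀) * M ^ 2) := by field_simp
      _ ≤ κ₀ * criticalTwoPoint 3 (Pi.single 0 (n : ℤ)) := this
  nlinarith

/-- **ECP ⟹ `UniformRegularity`** (route `SynchronousCoupling`): item 6150 by `twoPointDoubling_of_excessPropagation`, then
the landed item map 6150 ⟹ 4658 (`ItemMaps.uniformRegularity_of_doubling`). [folklore] -/
theorem uniformRegularity_of_excessPropagation (h₅ : (∃ K κ h₀ : ℝ, 2 ≤ K ∧ 0 < κ ∧ 0 < h₀ ∧ ∀ h ∈ Set.Ioo (0 : ℝ) h₀, ∀ n : ℕ, 1 ≤ n →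
      Literature.Probability.LatticeModels.criticalBeta 3 *
          ((n : ℝ) * h * Literature.Probability.LatticeModels.magnetizationInField 3
            (Literature.Probability.LatticeModels.criticalBeta 3) h) ≤ 1 →
      K * (Literature.Probability.LatticeModels.magnetizationInField 3
            (Literature.Probability.LatticeModels.criticalBeta 3) h) ^ 2 ≤
        Literature.Probability.LatticeModels.plusCorr 3 (Literature.Probability.LatticeModels.criticalBeta 3) h
          {0, Pi.single 0 (n : ℤ)} →
      (1 + κ) * (Literature.Probability.LatticeModels.magnetizationInField 3
            (Literature.Probability.LatticeModels.criticalBeta 3) h) ^ 2 ≤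
        Literature.Probability.LatticeModels.plusCorr 3 (Literature.Probability.LatticeModels.criticalBeta 3) h
          {0, Pi.single 0 (2 * (n : ℤ))})) :
    Summit.CriticalPhenomena.Ising3DConformalLimit.Theses.SynchronousCoupling.UniformRegularity :=
  monotoneRG_uniformRegularity_iff_synchronousCoupling.1
    (Summit.CriticalPhenomena.Ising3DConformalLimit.Cruxes.ExistsScaleCovariantLimit.TwoHierarchies.ItemMaps.uniformRegularity_of_doubling
      (twoPointDoubling_of_excessPropagation h₅))

/-- **The crux is exactly ECP**: `UniformRegularity ⟺ ECP` (landed `uniformRegularity_iff_doubling`, p120504, and the two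
transfers of this file). [folklore] -/
theorem uniformRegularity_iff_excessPropagation :
    Summit.CriticalPhenomena.Ising3DConformalLimit.Theses.SynchronousCoupling.UniformRegularity ↔
      (∃ K κ h₀ : ℝ, 2 ≤ K ∧ 0 < κ ∧ 0 < h₀ ∧ ∀ h ∈ Set.Ioo (0 : ℝ) h₀, ∀ n : ℕ, 1 ≤ n →
      Literature.Probability.LatticeModels.criticalBeta 3 *
          ((n : ℝ) * h * Literature.Probability.LatticeModels.magnetizationInField 3
            (Literature.Probability.LatticeModels.criticalBeta 3) h) ≤ 1 →
      K * (Literature.Probability.LatticeModels.magnetizationInField 3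
            (Literature.Probability.LatticeModels.criticalBeta 3) h) ^ 2 ≤
        Literature.Probability.LatticeModels.plusCorr 3 (Literature.Probability.LatticeModels.criticalBeta 3) h
          {0, Pi.single 0 (n : ℤ)} →
      (1 + κ) * (Literature.Probability.LatticeModels.magnetizationInField 3
            (Literature.Probability.LatticeModels.criticalBeta 3) h) ^ 2 ≤
        Literature.Probability.LatticeModels.plusCorr 3 (Literature.Probability.LatticeModels.criticalBeta 3) h
          {0, Pi.single 0 (2 * (n : ℤ))}) :=
  ⟨fun h => excessPropagation_of_twoPointDoubling
      ((Summit.CriticalPhenomena.Ising3DConformalLimit.Cruxes.ExistsScaleCovariantLimit.TwoHierarchies.ItemMaps.uniformRegularity_iff_doubling).1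
        (monotoneRG_uniformRegularity_iff_synchronousCoupling.2 h)),
    uniformRegularity_of_excessPropagation⟩

end Summit.CriticalPhenomena.Ising3DConformalLimit.Theorems.MagneticRuler

end
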